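import Summits.CriticalPhenomena.PercolationContinuityZ3.Theorems.PercNearOneGluingNoHeavyLowerTailKnQuestion8CoefficientwiseDisjointClusters
import HarnessLib

/-!
# Tools for THEOREM TC (GRAND on the trivial-core stratum of the conditioning vertex): confinement of the `x`-clusters,
# free-edge invariance of the `z`-clusters, and Harris on a product of two cubes

Support file (`--supports stmt-CriticalPhenomena-4575`, closed), prover `prim-cplus-coupling` (gen 29).  No definitions, no notations, no named
facts, no sorries; standard axioms.  Memo `prim-cplus-coupling/A5-COUPLING-gen28.md` §2.6 (THEOREM TC) and `A5-COUPLING-gen29.md`.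
Companion (the theorem itself): `…CoefficientwiseTrivialCore.lean`.

Setting (prim-lf-2's `Coefficientwise` files): a finite multigraph `ends : ι → Sym2 V`, an edge set `E₀`, colourings `c ⊆ E₀` (red; `E₀ \ c` blue),
`C_v(c) = openCluster (ends '' c) v`.  THEOREM TC says that conjecture GRAND (…CoefficientwiseGrandOneSided) holds on the colourings whose two `z`-clusters
meet only in `z`: there the colourings split into orbits `2^{components of the zone of z} × 2^{free edges}` on which the cluster quadruple
`(C_x(c), C_x(E₀∖c), C_z(c), C_z(E₀∖c))` is monotone in the grand order and the antipode is the colour swap, so Harris applies orbit by orbit.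
This file supplies the three ingredients that are not in prim-lf-2's component calculus (…ComponentFlip / …ComponentCube, written for the root `x`;
here it is used with root `z`):
* `Coefficientwise.openCluster_subset_of_closed` — the cluster of `x` lies in every vertex set containing `x` and closed under the red edges;
* `Coefficientwise.openCluster_subset_sdiff_incident` — **confinement**: if `W ⊆ C_z(c)` and `x ∉ C_z(c)`, the red cluster of `x` uses no edge
  meeting `W` (`C_x(c) ⊆ C_x(c ∖ I)` for any `I` all of whose `c`-edges meet `W`); hence moving a red-side component of `z` to the blue side can only
  ENLARGE `C_x(red)` and SHRINK `C_x(blue)`;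
* `Coefficientwise.openCluster_symmDiff_free`, `Coefficientwise.openCluster_sdiff_symmDiff_free` — recolouring edges that avoid the zone
  `C_z(c) ∪ C_z(E₀∖c)` away from `z` changes neither cluster of `z`;
* `Coefficientwise.harris_twoColouring_prod` — Harris' inequality in two-colouring form on the product of two cubes
  `P.powerset × Q.powerset` (transport of `harris_twoColouring_subpowerset` along `P ⊕ Q`).
[cite: KozmaNitzan2024, Questions 8–9 (§5.5 p. 36) (context: the Question-8 pocket covariance programme)]
-/

namespace Summit.CriticalPhenomena.PercolationContinuityZ3.Theorems

open Finset Literature.Probability.Percolation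
open scoped symmDiff

namespace Coefficientwise

variable {ι V : Type*}

/-- The red cluster of `x` is contained in every vertex set that contains `x` and is closed under the red edges.
[cite: KozmaNitzan2024, §5.5 (context only; folklore)] -/
theorem openCluster_subset_of_closed (ends : ι → Sym2 V) (c : Finset ι) (x : V) {S : Set V} (hx : x ∈ S)
    (hS : ∀ i ∈ c, ∀ a b, ends i = s(a, b) → a ∈ S → b ∈ S) :
    openCluster (ends '' (↑c : Set ι)) x ⊆ S := by
  intro y hy
  change (openGraph _).Reachable x y at hy
  rw [SimpleGraph.reachable_iff_reflTransGen] at hy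
  induction hy with
  | refl => exact hx
  | @tail b d _ hbd ih =>
    rw [openGraph_image_adj] at hbd
    obtain ⟨⟨j, hj, hje⟩, _⟩ := hbd
    exact hS j hj b d hje ih

/-- Symmetry of cluster membership: `y ∈ C_x(c) ↔ x ∈ C_y(c)`. [cite: KozmaNitzan2024, §5.5 (context only; folklore)] -/
theorem mem_openCluster_comm (ends : ι → Sym2 V) (c : Finset ι) (x y : V) :
    y ∈ openCluster (ends '' (↑c : Set ι)) x ↔ x ∈ openCluster (ends '' (↑c : Set ι)) y :=
  ⟨fun h => SimpleGraph.Reachable.symm h, fun h => SimpleGraph.Reachable.symm h⟩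

/-- **Confinement.**  If `W ⊆ C_z(c)` and `x ∉ C_z(c)`, then the red cluster of `x` uses no red edge meeting `W`: for every edge set `I` whose
members in `c` all meet `W`, `C_x(c) ⊆ C_x(c \ I)`.  (A red path from `x` touching `W` would join `x` to `z`.)
[cite: KozmaNitzan2024, §5.5 (context only; folklore)] -/
theorem openCluster_subset_sdiff_incident (ends : ι → Sym2 V) (c I : Finset ι) (x z : V) (W : Set V) [DecidableEq ι]
    (hW : W ⊆ openCluster (ends '' (↑c : Set ι)) z) (hx : x ∉ openCluster (ends '' (↑c : Set ι)) z)
    (hI : ∀ i ∈ c, i ∈ I → ∃ w, w ∈ W ∧ w ∈ ends i) :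
    openCluster (ends '' (↑c : Set ι)) x ⊆ openCluster (ends '' (↑(c \ I) : Set ι)) x := by
  set S : Set V := openCluster (ends '' (↑(c \ I) : Set ι)) x with hSdef
  have hSsub : S ⊆ openCluster (ends '' (↑c : Set ι)) x := openCluster_image_mono ends Finset.sdiff_subset x
  -- a vertex of `C_x(c)` lying in `C_z(c)` would put `x` in `C_z(c)`
  have key : ∀ a, a ∈ openCluster (ends '' (↑c : Set ι)) x → a ∈ openCluster (ends '' (↑c : Set ι)) z → False := by
    intro a hax haz
    have hxa : x ∈ openCluster (ends '' (↑c : Set ι)) a := (mem_openCluster_comm ends c x a).mp hax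
    exact hx (SimpleGraph.Reachable.trans haz (SimpleGraph.Reachable.symm ((mem_openCluster_comm ends c a x).mp hxa)))
  refine openCluster_subset_of_closed ends c x (S := S) (mem_openCluster_self _ _) ?_
  intro i hi a b he haS
  by_cases hiI : i ∈ I
  · exfalso
    obtain ⟨w, hwW, hwi⟩ := hI i hi hiI
    rw [he, Sym2.mem_iff] at hwi
    rcases hwi with rfl | rfl
    · exact key _ (hSsub haS) (hW hwW)
    · exact key _ (mem_openCluster_of_edge ends hi he (hSsub haS)) (hW hwW)
  · exact mem_openCluster_of_edge ends (Finset.mem_sdiff.mpr ⟨hi, hiI⟩) he haS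

/-- For `A ⊆ E₀`: `E₀ \ (c ∆ A) = (E₀ \ c) ∆ A`. [cite: KozmaNitzan2024, §5.5 (context only)] -/
theorem sdiff_symmDiff_eq (E₀ c A : Finset ι) [DecidableEq ι] (hA : A ⊆ E₀) : E₀ \ (c ∆ A) = (E₀ \ c) ∆ A := by
  ext i
  simp only [Finset.mem_sdiff, Finset.mem_symmDiff]
  have hAi : i ∈ A → i ∈ E₀ := fun h => hA h
  tauto

/-- **Free-edge invariance.**  If every end of every edge of `A ⊆ E₀` that lies in the zone `C_z(c) ∪ C_z(E₀ \ c)` equals `z`, then recolouring `A`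
does not change the red cluster of `z`: `C_z(c ∆ A) = C_z(c)`. [cite: KozmaNitzan2024, §5.5 (context only; folklore)] -/
theorem openCluster_symmDiff_free (ends : ι → Sym2 V) (E₀ c A : Finset ι) (z : V) [DecidableEq ι] (hA : A ⊆ E₀)
    (hfree : ∀ i ∈ A, ∀ w ∈ ends i,
      (w ∈ openCluster (ends '' (↑c : Set ι)) z ∨ w ∈ openCluster (ends '' (↑(E₀ \ c) : Set ι)) z) → w = z) :
    openCluster (ends '' (↑(c ∆ A) : Set ι)) z = openCluster (ends '' (↑c : Set ι)) z := by
  apply Set.Subset.antisymm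
  · -- `C_z(c ∆ A) ⊆ C_z(c)`: `C_z(c)` is closed under the edges of `c ∆ A`
    refine openCluster_subset_of_closed ends (c ∆ A) z (mem_openCluster_self _ _) ?_
    intro i hi a b he haS
    rcases Finset.mem_symmDiff.mp hi with ⟨hic, -⟩ | ⟨hiA, hic⟩
    · exact mem_openCluster_of_edge ends hic he haS
    · have haz : a = z := hfree i hiA a (by rw [he]; exact Sym2.mem_mk_left a b) (Or.inl haS)
      subst haz
      by_cases hba : b = a
      · rw [hba]; exact mem_openCluster_self _ _
      · have hib : i ∈ E₀ \ c := Finset.mem_sdiff.mpr ⟨hA hiA, hic⟩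
        have hb : b ∈ openCluster (ends '' (↑(E₀ \ c) : Set ι)) a := mem_openCluster_of_edge ends hib he (mem_openCluster_self _ _)
        have hbz : b = a := hfree i hiA b (by rw [he]; exact Sym2.mem_mk_right a b) (Or.inr hb)
        exact absurd hbz hba
  · -- `C_z(c) ⊆ C_z(c \ A) ⊆ C_z(c ∆ A)`
    have h1 : openCluster (ends '' (↑c : Set ι)) z ⊆ openCluster (ends '' (↑(c \ A) : Set ι)) z := by
      refine openCluster_subset_of_closed ends c z (mem_openCluster_self _ _) ?_
      intro i hi a b he haS
      by_cases hiA : i ∈ A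
      · have haS' : a ∈ openCluster (ends '' (↑c : Set ι)) z := openCluster_image_mono ends Finset.sdiff_subset z haS
        have haz : a = z := hfree i hiA a (by rw [he]; exact Sym2.mem_mk_left a b) (Or.inl haS')
        subst haz
        by_cases hba : b = a
        · rw [hba]; exact mem_openCluster_self _ _
        · have hb : b ∈ openCluster (ends '' (↑c : Set ι)) a := mem_openCluster_of_edge ends hi he (mem_openCluster_self _ _)
          have hbz : b = a := hfree i hiA b (by rw [he]; exact Sym2.mem_mk_right a b) (Or.inl hb)
          exact absurd hbz hba
      · exact mem_openCluster_of_edge ends (Finset.mem_sdiff.mpr ⟨hi, hiA⟩) he haS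
    have h2 : openCluster (ends '' (↑(c \ A) : Set ι)) z ⊆ openCluster (ends '' (↑(c ∆ A) : Set ι)) z := by
      refine openCluster_image_mono ends ?_ z
      intro i hi
      rw [Finset.mem_sdiff] at hi
      exact Finset.mem_symmDiff.mpr (Or.inl hi)
    exact h1.trans h2

/-- Free-edge invariance for the blue cluster of `z`: under the hypothesis of `openCluster_symmDiff_free` (and `c ⊆ E₀`),
`C_z(E₀ \ (c ∆ A)) = C_z(E₀ \ c)`. [cite: KozmaNitzan2024, §5.5 (context only; folklore)] -/
theorem openCluster_sdiff_symmDiff_free (ends : ι → Sym2 V) (E₀ c A : Finset ι) (z : V) [DecidableEq ι] (hc : c ⊆ E₀) (hA : A ⊆ E₀)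
    (hfree : ∀ i ∈ A, ∀ w ∈ ends i,
      (w ∈ openCluster (ends '' (↑c : Set ι)) z ∨ w ∈ openCluster (ends '' (↑(E₀ \ c) : Set ι)) z) → w = z) :
    openCluster (ends '' (↑(E₀ \ (c ∆ A)) : Set ι)) z = openCluster (ends '' (↑(E₀ \ c) : Set ι)) z := by
  rw [sdiff_symmDiff_eq E₀ c A hA]
  have hcc : E₀ \ (E₀ \ c) = c := Finset.sdiff_sdiff_eq_self hc
  refine openCluster_symmDiff_free ends E₀ (E₀ \ c) A z hA ?_
  intro i hi w hw hwU
  rw [hcc] at hwU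
  exact hfree i hi w hw (hwU.symm)

/-- **Harris on a product of two cubes, two-colouring form.**  For `Φ, Γ : Finset α → Finset β → ℝ` monotone in both arguments,
`0 ≤ Σ_{B ⊆ P} Σ_{t ⊆ Q} (Φ(B,t) − Φ(P∖B, Q∖t))·(Γ(B,t) − Γ(P∖B, Q∖t))`.
[cite: KozmaNitzan2024, §5.5 (context: Harris 1960)] -/
theorem harris_twoColouring_prod {α β : Type*} [DecidableEq α] [DecidableEq β] (P : Finset α) (Q : Finset β)
    (Φ Γ : Finset α → Finset β → ℝ)
    (hΦ : ∀ B B' t t', B ⊆ B' → t ⊆ t' → Φ B t ≤ Φ B' t') (hΓ : ∀ B B' t t', B ⊆ B' → t ⊆ t' → Γ B t ≤ Γ B' t') :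
    0 ≤ ∑ B ∈ P.powerset, ∑ t ∈ Q.powerset, (Φ B t - Φ (P \ B) (Q \ t)) * (Γ B t - Γ (P \ B) (Q \ t)) := by
  classical
  set Cs : Finset (α ⊕ β) := P.disjSum Q with hCs
  set pA : Finset (α ⊕ β) → Finset α := fun S => P.filter (fun a => (Sum.inl a : α ⊕ β) ∈ S) with hpA
  set pB : Finset (α ⊕ β) → Finset β := fun S => Q.filter (fun b => (Sum.inr b : α ⊕ β) ∈ S) with hpB
  have pA_mono : ∀ {S S' : Finset (α ⊕ β)}, S ⊆ S' → pA S ⊆ pA S' := by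
    intro S S' h a ha
    simp only [hpA, Finset.mem_filter] at ha ⊢
    exact ⟨ha.1, h ha.2⟩
  have pB_mono : ∀ {S S' : Finset (α ⊕ β)}, S ⊆ S' → pB S ⊆ pB S' := by
    intro S S' h b hb
    simp only [hpB, Finset.mem_filter] at hb ⊢
    exact ⟨hb.1, h hb.2⟩
  have key := harris_twoColouring_subpowerset Cs (fun S => Φ (pA S) (pB S)) (fun S => Γ (pA S) (pB S))
    (fun S S' h => hΦ _ _ _ _ (pA_mono h) (pB_mono h)) (fun S S' h => hΓ _ _ _ _ (pA_mono h) (pB_mono h))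
  -- complements inside `Cs`
  have pA_compl : ∀ S ∈ Cs.powerset, pA (Cs \ S) = P \ pA S := by
    intro S _
    ext a
    simp only [hpA, Finset.mem_filter, Finset.mem_sdiff, hCs, Finset.inl_mem_disjSum]
    tauto
  have pB_compl : ∀ S ∈ Cs.powerset, pB (Cs \ S) = Q \ pB S := by
    intro S _
    ext b
    simp only [hpB, Finset.mem_filter, Finset.mem_sdiff, hCs, Finset.inr_mem_disjSum]
    tauto
  rw [← Finset.sum_product'] 
  refine key.trans_eq ?_
  refine Finset.sum_nbij' (fun S => (pA S, pB S)) (fun p => (p.1.disjSum p.2 : Finset (α ⊕ β))) ?_ ?_ ?_ ?_ ?_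
  · intro S _
    rw [Finset.mem_product, Finset.mem_powerset, Finset.mem_powerset]
    exact ⟨Finset.filter_subset _ _, Finset.filter_subset _ _⟩
  · rintro ⟨B, t⟩ hp
    rw [Finset.mem_product, Finset.mem_powerset, Finset.mem_powerset] at hp
    rw [Finset.mem_powerset, hCs]
    exact Finset.disjSum_mono hp.1 hp.2
  · intro S hS
    rw [Finset.mem_powerset] at hS
    ext e
    rcases e with a | b
    · simp only [Finset.inl_mem_disjSum, hpA, Finset.mem_filter]
      constructor
      · rintro ⟨-, h⟩; exact h
      · intro h
        have := hS h
        rw [hCs, Finset.inl_mem_disjSum] at this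
        exact ⟨this, h⟩
    · simp only [Finset.inr_mem_disjSum, hpB, Finset.mem_filter]
      constructor
      · rintro ⟨-, h⟩; exact h
      · intro h
        have := hS h
        rw [hCs, Finset.inr_mem_disjSum] at this
        exact ⟨this, h⟩
  · rintro ⟨B, t⟩ hp
    rw [Finset.mem_product, Finset.mem_powerset, Finset.mem_powerset] at hp
    simp only [hpA, hpB, Prod.mk.injEq]
    constructor
    · ext a
      simp only [Finset.mem_filter, Finset.inl_mem_disjSum]
      exact ⟨fun h => h.2, fun h => ⟨hp.1 h, h⟩⟩
    · ext b
      simp only [Finset.mem_filter, Finset.inr_mem_disjSum]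
      exact ⟨fun h => h.2, fun h => ⟨hp.2 h, h⟩⟩
  · intro S hS
    simp only [pA_compl S hS, pB_compl S hS]


/-- **Harris on a product of two cubes, twisted form.**  If `Φ, Γ` become monotone (on the sub-cubes of `P`, `Q`) after the cube automorphism
`(B, t) ↦ (B ∆ D₁, t ∆ D₂)` (`D₁ ⊆ P`, `D₂ ⊆ Q`), the two-colouring sum of `Φ, Γ` over `P.powerset × Q.powerset` is still `≥ 0`
(the automorphism commutes with the antipode). [cite: KozmaNitzan2024, §5.5 (context: Harris 1960)] -/
theorem harris_twoColouring_prod_twist {α β : Type*} [DecidableEq α] [DecidableEq β] (P : Finset α) (Q : Finset β)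
    (D₁ : Finset α) (D₂ : Finset β) (hD₁ : D₁ ⊆ P) (hD₂ : D₂ ⊆ Q) (Φ Γ : Finset α → Finset β → ℝ)
    (hΦ : ∀ B B' t t', B' ⊆ P → t' ⊆ Q → B ⊆ B' → t ⊆ t' → Φ (B ∆ D₁) (t ∆ D₂) ≤ Φ (B' ∆ D₁) (t' ∆ D₂))
    (hΓ : ∀ B B' t t', B' ⊆ P → t' ⊆ Q → B ⊆ B' → t ⊆ t' → Γ (B ∆ D₁) (t ∆ D₂) ≤ Γ (B' ∆ D₁) (t' ∆ D₂)) :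
    0 ≤ ∑ B ∈ P.powerset, ∑ t ∈ Q.powerset, (Φ B t - Φ (P \ B) (Q \ t)) * (Γ B t - Γ (P \ B) (Q \ t)) := by
  set Φ' : Finset α → Finset β → ℝ := fun B t => Φ ((B ∩ P) ∆ D₁) ((t ∩ Q) ∆ D₂) with hΦ'
  set Γ' : Finset α → Finset β → ℝ := fun B t => Γ ((B ∩ P) ∆ D₁) ((t ∩ Q) ∆ D₂) with hΓ'
  have hΦ'm : ∀ B B' t t', B ⊆ B' → t ⊆ t' → Φ' B t ≤ Φ' B' t' := fun B B' t t' hB ht =>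
    hΦ _ _ _ _ Finset.inter_subset_right Finset.inter_subset_right
      (Finset.inter_subset_inter hB (subset_refl P)) (Finset.inter_subset_inter ht (subset_refl Q))
  have hΓ'm : ∀ B B' t t', B ⊆ B' → t ⊆ t' → Γ' B t ≤ Γ' B' t' := fun B B' t t' hB ht =>
    hΓ _ _ _ _ Finset.inter_subset_right Finset.inter_subset_right
      (Finset.inter_subset_inter hB (subset_refl P)) (Finset.inter_subset_inter ht (subset_refl Q))
  have key := harris_twoColouring_prod P Q Φ' Γ' hΦ'm hΓ'm
  rw [← Finset.sum_product'] at key ⊢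
  -- facts about the twist
  have twP : ∀ B, B ⊆ P → B ∆ D₁ ⊆ P := fun B hB i hi => by
    rcases Finset.mem_symmDiff.mp hi with ⟨h, -⟩ | ⟨h, -⟩
    · exact hB h
    · exact hD₁ h
  have twQ : ∀ t, t ⊆ Q → t ∆ D₂ ⊆ Q := fun t ht i hi => by
    rcases Finset.mem_symmDiff.mp hi with ⟨h, -⟩ | ⟨h, -⟩
    · exact ht h
    · exact hD₂ h
  have cP : ∀ B, B ⊆ P → (P \ B) ∆ D₁ = P \ (B ∆ D₁) := fun B hB => by
    ext i
    simp only [Finset.mem_sdiff, Finset.mem_symmDiff]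
    have h1 : i ∈ B → i ∈ P := fun h => hB h
    have h2 : i ∈ D₁ → i ∈ P := fun h => hD₁ h
    tauto
  have cQ : ∀ t, t ⊆ Q → (Q \ t) ∆ D₂ = Q \ (t ∆ D₂) := fun t ht => by
    ext i
    simp only [Finset.mem_sdiff, Finset.mem_symmDiff]
    have h1 : i ∈ t → i ∈ Q := fun h => ht h
    have h2 : i ∈ D₂ → i ∈ Q := fun h => hD₂ h
    tauto
  refine key.trans_eq ?_
  refine Finset.sum_nbij' (fun p => (p.1 ∆ D₁, p.2 ∆ D₂)) (fun p => (p.1 ∆ D₁, p.2 ∆ D₂)) ?_ ?_ ?_ ?_ ?_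
  · rintro ⟨B, t⟩ hp
    rw [Finset.mem_product, Finset.mem_powerset, Finset.mem_powerset] at hp ⊢
    exact ⟨twP B hp.1, twQ t hp.2⟩
  · rintro ⟨B, t⟩ hp
    rw [Finset.mem_product, Finset.mem_powerset, Finset.mem_powerset] at hp ⊢
    exact ⟨twP B hp.1, twQ t hp.2⟩
  · rintro ⟨B, t⟩ _
    simp only [symmDiff_symmDiff_cancel_right]
  · rintro ⟨B, t⟩ _
    simp only [symmDiff_symmDiff_cancel_right]
  · rintro ⟨B, t⟩ hp
    rw [Finset.mem_product, Finset.mem_powerset, Finset.mem_powerset] at hp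
    have hBP : B ∩ P = B := Finset.inter_eq_left.mpr hp.1
    have htQ : t ∩ Q = t := Finset.inter_eq_left.mpr hp.2
    have hBP' : (P \ B) ∩ P = P \ B := Finset.inter_eq_left.mpr Finset.sdiff_subset
    have htQ' : (Q \ t) ∩ Q = Q \ t := Finset.inter_eq_left.mpr Finset.sdiff_subset
    simp only [hΦ', hΓ', hBP, htQ, hBP', htQ', cP B hp.1, cQ t hp.2]

end Coefficientwise

end Summit.CriticalPhenomena.PercolationContinuityZ3.Theorems
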